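import Mathlib
import Literature.Analysis.OperatorTheory.HilbertBasisSchurTest
import Summits.NavierStokesRegularity.FluidComputer.SkewCutGalerkinSections

/-!
# Skew-cut certificate: from section-matrix eigenpairs and a Schur-bounded first-order matrix to an
`H^∞` eigenvector in the open bracket (END-TO-END, matrix inputs; diagonal / Hilbert-basis setting)
(instab4 g4 — implementation 2 of the skew-cut X0 certifier, cell `ns-blowup`, 2026-08-26)

HONEST FRAMING (human ruling D-0035): nothing here is a claim about Navier–Stokes blow-up.
WHAT THIS IS NOT: not NS evidence. MODEL lane. `SkewCutGalerkinMaster.exists_smooth_eigenvector_Ioo`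
(p443836) takes the first-order part as a bounded operator `T` and the Galerkin data as vectors. Here
both are replaced by what the certifiers and implementation 1's kernel statements actually hold:

* the MATRIX `t : ι → ι → 𝕜` of the relative bound `A (x₀ − L₀)⁻¹` (exact entries `A_ij d_j`), with
  absolutely summable rows `≤ R₀` and columns `≤ C₀`, `R₀ C₀ < 1` — the operator `T` is then BUILT by
  the Schur test (`Literature…HilbertBasisSchurTest.exists_clm_of_schur_bound`, p441463), with
  `⟪b i, T b j⟫ = t i j`, `‖T‖ ≤ √(R₀C₀) < 1`;
* MATRIX EIGENPAIRS `(x_n, c_n)` of the finite sections `[ℓ_i δ_ij + t_ij (x₀ − ℓ_j)]` on a monotone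
  exhausting family of finite index sets `F_n`, normalised `Σ|c_n j|² = 1`, with the graph bound
  `Σ_{F_n} |(x₀ − ℓ_j) c_n j|² ≤ C²` and `x_n ∈ [a, c]` (instab3's `exists_eigenvalue_of_certificate` +
  `graph_bound` after assembly) — turned into Galerkin data by `SkewCutGalerkinSections` (p445411);
* injectivity of `R_a, R_c` for the operator with matrix `t` (Thm 1′ (a) at the ends; e.g. by
  `SkewCutGalerkinTailForm.not_eigenvalue_of_structure` / `SkewCutGalerkinInjectivity`).

CONCLUSION (`exists_smooth_eigenvector_Ioo_of_sections`): a bounded `T` with matrix `t`, and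
`λ ∈ (a, c)`, `‖v‖ = 1` with `ℓ_i ⟪b i, v⟫ + Σ_{j ∈ nbr i} t_ij (x₀ − ℓ_j) ⟪b j, v⟫ = λ ⟪b i, v⟫` for
all `i` and `Σ_i w_i^{2s} |⟪b i, v⟫|² < ∞` for every `s`.

Mathlib + the files named; no new definitions.
-/

noncomputable section

namespace Summit.NavierStokesRegularity.FluidComputer.SkewCutGalerkinFromSections

open Filter Topology Submodule
open scoped InnerProductSpace

variable {𝕜 H : Type*} [RCLike 𝕜] [NormedAddCommGroup H] [InnerProductSpace 𝕜 H] [CompleteSpace H]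
variable {ι : Type*} (b : HilbertBasis ι 𝕜 H)

/-- **END-TO-END with matrix inputs** (see the module docstring). -/
theorem exists_smooth_eigenvector_Ioo_of_sections [DecidableEq ι]
    -- free part and its resolvent
    (ℓ : ι → ℝ) (x₀ : ℝ) (d : lp (fun _ : ι => 𝕜) ⊤) (hd : ∀ i, d i * ((x₀ : 𝕜) - (ℓ i : 𝕜)) = 1)
    (hd0 : Tendsto (fun i => ‖d i‖) cofinite (𝓝 0))
    -- the matrix of the relative bound: Schur data, band, first-order growth
    (t : ι → ι → 𝕜) {R₀ C₀ : ℝ} (hrow : ∀ i, Summable fun j => ‖t i j‖)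
    (hR : ∀ i, ∑' j, ‖t i j‖ ≤ R₀) (hcol : ∀ j, Summable fun i => ‖t i j‖)
    (hC₀ : ∀ j, ∑' i, ‖t i j‖ ≤ C₀) (hR0 : 0 ≤ R₀) (hC0 : 0 ≤ C₀) (hq : R₀ * C₀ < 1)
    (nbr : ι → Finset ι) (hsymm : ∀ i j, j ∈ nbr i ↔ i ∈ nbr j) {W : ℕ}
    (hW : ∀ i, (nbr i).card ≤ W) (ht0 : ∀ i j, j ∉ nbr i → t i j = 0)
    (wgt : ι → ℝ) (hw0 : ∀ i, 0 ≤ wgt i) (hwℓ : ∀ i, wgt i ^ 2 ≤ 1 + |ℓ i|) {K : ℝ} (hK : 0 ≤ K)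
    (ha : ∀ i j, j ∈ nbr i → ‖t i j * ((x₀ : 𝕜) - (ℓ j : 𝕜))‖ ≤ K * wgt j)
    {L : ℝ} (hLnn : 0 ≤ L) (hL : ∀ i j, j ∈ nbr i → wgt i ≤ L * wgt j)
    {M : ℝ} (hM : ∀ i, ‖d i‖ * wgt i ≤ M)
    -- matrix eigenpairs of the finite sections
    (F : ℕ → Finset ι) (hF : Monotone F) (hFex : ∀ i, ∃ n, i ∈ F n)
    (c : ℕ → ι → 𝕜) (xs : ℕ → ℝ) {a e : ℝ} (hxs : ∀ n, xs n ∈ Set.Icc a e)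
    (heig : ∀ n, ∀ i ∈ F n, (ℓ i : 𝕜) * c n i +
      ∑ j ∈ F n, (t i j * ((x₀ : 𝕜) - (ℓ j : 𝕜))) * c n j = (xs n : 𝕜) * c n i)
    (hnorm : ∀ n, ∑ j ∈ F n, ‖c n j‖ ^ 2 = 1) {C : ℝ} (hCnn : 0 ≤ C)
    (hgraph : ∀ n, ∑ j ∈ F n, ‖((x₀ : 𝕜) - (ℓ j : 𝕜)) * c n j‖ ^ 2 ≤ C ^ 2)
    -- Theorem 1′ (a) at the two ends, for the operator with matrix `t`
    (hinj : ∀ T : H →L[𝕜] H, (∀ i j, ⟪b i, T (b j)⟫_𝕜 = t i j) →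
      (∀ w, ((1 : H →L[𝕜] H) - T - ((x₀ : 𝕜) - (a : 𝕜)) • b.diagonalCLM d) w = 0 → w = 0) ∧
      (∀ w, ((1 : H →L[𝕜] H) - T - ((x₀ : 𝕜) - (e : 𝕜)) • b.diagonalCLM d) w = 0 → w = 0)) :
    ∃ T : H →L[𝕜] H, (∀ i j, ⟪b i, T (b j)⟫_𝕜 = t i j) ∧ ‖T‖ ≤ Real.sqrt (R₀ * C₀) ∧
      ∃ lam ∈ Set.Ioo a e, ∃ v : H, ‖v‖ = 1 ∧
        (∀ i, (ℓ i : 𝕜) * ⟪b i, v⟫_𝕜 +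
            ∑ j ∈ nbr i, (t i j * ((x₀ : 𝕜) - (ℓ j : 𝕜))) * ⟪b j, v⟫_𝕜 = (lam : 𝕜) * ⟪b i, v⟫_𝕜) ∧
        ∀ s : ℕ, Summable fun i => wgt i ^ (2 * s) * ‖⟪b i, v⟫_𝕜‖ ^ 2 := by
  -- build `T` by the Schur test
  obtain ⟨T, -, -, hTt, hTn, -⟩ :=
    Literature.Analysis.OperatorTheory.HilbertBasisSchurTest.exists_clm_of_schur_bound b t hrow hR
      hcol hC₀ hR0 hC0
  have hT1 : ‖T‖ < 1 := by
    refine lt_of_le_of_lt hTn ?_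
    rw [show (1 : ℝ) = Real.sqrt 1 from Real.sqrt_one.symm]
    exact Real.sqrt_lt_sqrt (mul_nonneg hR0 hC0) hq
  -- Galerkin data from the section eigenpairs
  set u : ℕ → H := fun n => ∑ j ∈ F n, (((x₀ : 𝕜) - (ℓ j : 𝕜)) * c n j) • b j with hu
  have heig' : ∀ n, ∀ i ∈ F n, (ℓ i : 𝕜) * c n i +
      ∑ j ∈ F n, (⟪b i, T (b j)⟫_𝕜 * ((x₀ : 𝕜) - (ℓ j : 𝕜))) * c n j = (xs n : 𝕜) * c n i := by
    intro n i hi; simp_rw [hTt]; exact heig n i hi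
  have hdat := fun n => SkewCutGalerkinSections.galerkin_datum_of_section_eigenpair b ℓ x₀ d hd T
    (F n) (c n) (xs n : 𝕜) (heig' n)
  have hv1 : ∀ n, ‖b.diagonalCLM d (u n)‖ = 1 := fun n => by
    rw [hu, (hdat n).2.1]
    have h := SkewCutGalerkinSections.norm_sq_sum_smul_basis b (F n) (c n)
    rw [hnorm n] at h
    have h0 : 0 ≤ ‖∑ j ∈ F n, c n j • b j‖ := norm_nonneg _
    nlinarith [h, h0]
  have hCn : ∀ n, ‖u n‖ ≤ C := fun n => by
    have h := SkewCutGalerkinSections.norm_sq_sum_smul_basis b (F n)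
      (fun j => ((x₀ : 𝕜) - (ℓ j : 𝕜)) * c n j)
    have h2 : ‖u n‖ ^ 2 ≤ C ^ 2 := by rw [hu, h]; exact hgraph n
    exact (pow_le_pow_iff_left₀ (norm_nonneg _) hCnn two_ne_zero).mp h2
  -- the remaining inputs of the master theorem, in terms of `T`
  have ht0' : ∀ i j, j ∉ nbr i → ⟪b i, T (b j)⟫_𝕜 = 0 := fun i j hj => by rw [hTt, ht0 i j hj]
  have ha' : ∀ i j, j ∈ nbr i → ‖⟪b i, T (b j)⟫_𝕜 * ((x₀ : 𝕜) - (ℓ j : 𝕜))‖ ≤ K * wgt j :=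
    fun i j hj => by rw [hTt]; exact ha i j hj
  have hF' : Monotone fun n => ((F n : Set ι)) := fun m n hmn => Finset.coe_subset.2 (hF hmn)
  have hFex' : ∀ i, ∃ n, i ∈ (F n : Set ι) := fun i => by
    obtain ⟨n, hn⟩ := hFex i; exact ⟨n, Finset.mem_coe.2 hn⟩
  obtain ⟨hinj_a, hinj_e⟩ := hinj T hTt
  obtain ⟨lam, hlam, v, hv1', heigv, hreg⟩ :=
    SkewCutGalerkinMaster.exists_smooth_eigenvector_Ioo b ℓ x₀ d hd hd0 T hT1 nbr hsymm hW ht0' wgt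
      hw0 hwℓ hK ha' hLnn hL hM (fun n => (F n : Set ι)) hF' hFex' u (fun n => (hdat n).1) hv1 hCn
      xs hxs (fun n => (hdat n).2.2) hinj_a hinj_e
  refine ⟨T, hTt, hTn, lam, hlam, v, hv1', fun i => ?_, hreg⟩
  have h := heigv i
  simp_rw [hTt] at h
  exact h

/-- **Variant with the coordinate formula handed to the injectivity obligation** (g4 append): the
operator built by the Schur test is unique and acts in coordinates by `⟪b i, T x⟫ = Σ_j t_ij ⟪b j, x⟫`
(absolutely convergent); the end hypotheses may use both facts. -/
theorem exists_smooth_eigenvector_Ioo_of_sections' [DecidableEq ι]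
    (ℓ : ι → ℝ) (x₀ : ℝ) (d : lp (fun _ : ι => 𝕜) ⊤) (hd : ∀ i, d i * ((x₀ : 𝕜) - (ℓ i : 𝕜)) = 1)
    (hd0 : Tendsto (fun i => ‖d i‖) cofinite (𝓝 0))
    (t : ι → ι → 𝕜) {R₀ C₀ : ℝ} (hrow : ∀ i, Summable fun j => ‖t i j‖)
    (hR : ∀ i, ∑' j, ‖t i j‖ ≤ R₀) (hcol : ∀ j, Summable fun i => ‖t i j‖)
    (hC₀ : ∀ j, ∑' i, ‖t i j‖ ≤ C₀) (hR0 : 0 ≤ R₀) (hC0 : 0 ≤ C₀) (hq : R₀ * C₀ < 1)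
    (nbr : ι → Finset ι) (hsymm : ∀ i j, j ∈ nbr i ↔ i ∈ nbr j) {W : ℕ}
    (hW : ∀ i, (nbr i).card ≤ W) (ht0 : ∀ i j, j ∉ nbr i → t i j = 0)
    (wgt : ι → ℝ) (hw0 : ∀ i, 0 ≤ wgt i) (hwℓ : ∀ i, wgt i ^ 2 ≤ 1 + |ℓ i|) {K : ℝ} (hK : 0 ≤ K)
    (ha : ∀ i j, j ∈ nbr i → ‖t i j * ((x₀ : 𝕜) - (ℓ j : 𝕜))‖ ≤ K * wgt j)
    {L : ℝ} (hLnn : 0 ≤ L) (hL : ∀ i j, j ∈ nbr i → wgt i ≤ L * wgt j)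
    {M : ℝ} (hM : ∀ i, ‖d i‖ * wgt i ≤ M)
    (F : ℕ → Finset ι) (hF : Monotone F) (hFex : ∀ i, ∃ n, i ∈ F n)
    (c : ℕ → ι → 𝕜) (xs : ℕ → ℝ) {a e : ℝ} (hxs : ∀ n, xs n ∈ Set.Icc a e)
    (heig : ∀ n, ∀ i ∈ F n, (ℓ i : 𝕜) * c n i +
      ∑ j ∈ F n, (t i j * ((x₀ : 𝕜) - (ℓ j : 𝕜))) * c n j = (xs n : 𝕜) * c n i)
    (hnorm : ∀ n, ∑ j ∈ F n, ‖c n j‖ ^ 2 = 1) {C : ℝ} (hCnn : 0 ≤ C)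
    (hgraph : ∀ n, ∑ j ∈ F n, ‖((x₀ : 𝕜) - (ℓ j : 𝕜)) * c n j‖ ^ 2 ≤ C ^ 2)
    (hinj : ∀ T : H →L[𝕜] H, (∀ i j, ⟪b i, T (b j)⟫_𝕜 = t i j) →
      (∀ x i, ⟪b i, T x⟫_𝕜 = ∑' j, t i j * ⟪b j, x⟫_𝕜) →
      (∀ (x : H) i, Summable fun j => t i j * ⟪b j, x⟫_𝕜) →
      (∀ T' : H →L[𝕜] H, (∀ i j, ⟪b i, T' (b j)⟫_𝕜 = t i j) → T' = T) →
      (∀ w, ((1 : H →L[𝕜] H) - T - ((x₀ : 𝕜) - (a : 𝕜)) • b.diagonalCLM d) w = 0 → w = 0) ∧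
      (∀ w, ((1 : H →L[𝕜] H) - T - ((x₀ : 𝕜) - (e : 𝕜)) • b.diagonalCLM d) w = 0 → w = 0)) :
    ∃ T : H →L[𝕜] H, (∀ i j, ⟪b i, T (b j)⟫_𝕜 = t i j) ∧ ‖T‖ ≤ Real.sqrt (R₀ * C₀) ∧
      ∃ lam ∈ Set.Ioo a e, ∃ v : H, ‖v‖ = 1 ∧
        (∀ i, (ℓ i : 𝕜) * ⟪b i, v⟫_𝕜 +
            ∑ j ∈ nbr i, (t i j * ((x₀ : 𝕜) - (ℓ j : 𝕜))) * ⟪b j, v⟫_𝕜 = (lam : 𝕜) * ⟪b i, v⟫_𝕜) ∧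
        ∀ s : ℕ, Summable fun i => wgt i ^ (2 * s) * ‖⟪b i, v⟫_𝕜‖ ^ 2 := by
  -- the Schur operator with its coordinate formula and uniqueness
  obtain ⟨T, hTc, hTs, hTt, -, hTu⟩ :=
    Literature.Analysis.OperatorTheory.HilbertBasisSchurTest.exists_clm_of_schur_bound b t hrow hR
      hcol hC₀ hR0 hC0
  have hTc' : ∀ x i, ⟪b i, T x⟫_𝕜 = ∑' j, t i j * ⟪b j, x⟫_𝕜 := fun x i => by
    rw [← b.repr_apply_apply, hTc]; simp_rw [b.repr_apply_apply]
  have hTs' : ∀ (x : H) i, Summable fun j => t i j * ⟪b j, x⟫_𝕜 := fun x i => by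
    simp_rw [← b.repr_apply_apply]; exact hTs x i
  refine exists_smooth_eigenvector_Ioo_of_sections b ℓ x₀ d hd hd0 t hrow hR hcol hC₀ hR0 hC0 hq nbr
    hsymm hW ht0 wgt hw0 hwℓ hK ha hLnn hL hM F hF hFex c xs hxs heig hnorm hCnn hgraph
    fun T' hT' => ?_
  -- any operator with this matrix is the Schur operator
  have hTT' : T' = T := hTu T' hT'
  subst hTT'
  exact hinj T' hT' hTc' hTs' hTu

end Summit.NavierStokesRegularity.FluidComputer.SkewCutGalerkinFromSections

end
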